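/-
Copyright (c) 2026 the pub-hodgecm-mathlib formalisation cell (harness21).  Prover seat hodgecm-mathlib-F0P3a-p02 (g17): road «S3-ram» (LEAD F0P3a-plan (g12);
architect A-p16 (g31); (α₂) type-(2) design F0P3a-p07 (g13)), organ (d-iv-col-fin) «COLLAR CENSUS, finite-field half» of ORGAN-CARD (Cnt2) 1cbf3608 §1 (statement sheet
F0P3a-p07 (g13) 2026-09-02 00:32:45Z ∕ 00:33:23Z); 2026-09-02.
-/
import Literature.NumberTheory.Rogawski1990.DepthZeroKappaTransferTypeOneRamifiedAxisEndTwists   -- ★ p847254 (this lineage): `two_mul_card_filter_quadraticChar_eq` & co. (generic χ-counting)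
import Literature.FieldTheory.FiniteFields.JacobsthalSums                                     -- ★ `companionSum_two`: `Σ_c χ(c² + a) = −1` (`a ≠ 0`)
import HarnessLib

/-!
# The depth-zero κ-transfer at a tame-ramified place, TYPE (2): the COLLAR CENSUS (finite-field half) — on the `q − 1` collar lines `v_b` of an axis vertex,
# `Q(v_b) = g·(A + h·C·b²)`; null lines `1 + χ(−AhC)`, class split `2·N_σ = q − 2 − χ(−AhC) − σ·(χ(−ghC) + χ(−gA))` (Rogawski 1990 §4.9; Kottwitz 1986 §3)

Topic `NumberTheory/Rogawski1990`; namespace `Literature.NumberTheory.Rogawski1990`.  THEOREMS ONLY (no definition, no instance, no notation, no named fact, no `sorry`);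
kernel lane `--supports stmt-HodgeConjecture-24833`.  Cell `pub/hodgecm-mathlib` (D-0151), crux H413; road «S3-ram» (Literature seeding, count-neutral), the type-(2) `G`-side
(fold sockets :293∕:366 `stub_typeTwo_GSide_{even,odd}_ram`; (α₂) design F0P3a-p07 (g13) `DESIGN-A2d-TypeTwoGSide.v1_3`, ORGAN-CARD (Cnt2) 1cbf3608): the laws (S-0), (S-1±) of the
five signed strata counts need, per AXIS vertex `M = B ⊕ 𝒪e` of the hyperbolic literal `t₀`, the labels of its `(q−1)·q` COLLAR children (the children through the `q − 1`
non-axial isotropic lines of `M̄ = B̄ ⊕ kē`; the `q` gluings along one line all carry the line's label — COLLAR-law-check 1c2ee4ee): label `0` iff `Q(v) := ⟨v, Ȳ_M v⟩ = 0`, else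
`1σ` with `σ = χ(−Q(v))`.  THE DATUM (p07's statement sheet): `k` the residue field (`char ≠ 2`), `B̄ = ⟨ē₀, ē₂⟩` hyperbolic, Gram matrix of `M̄` in `(ē₀, ē₁, ē₂)` equal to
`g·antidiag(1, h, 1)` (`g, h ∈ k^×`), leading term `Ȳ_M = Ȳ_B ⊕ μ` with `Ȳ_B : ē₀ ↦ xē₀ + Aē₂, ē₂ ↦ xē₂` (scalar `x` plus the nilpotent `ē₀ ↦ Aē₂`), `C := μ − x`; the non-axial
isotropic lines are `v_b = ē₀ + bē₁ − (hb²∕2)ē₂`, `b ∈ k^×` (the axial lines `ē₀` (`b = 0`) and `ē₂` excluded), and **`Q(v_b) = g·(A + h·C·b²)`** (`collarQ_eq`).  THE CENSUS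
(all over `b ∈ k^×`): `A·C ≠ 0`: `#{Q = 0} = 1 + χ(−AhC)` (`card_collarNull_eq`), `Σ χ(−Q) = −(χ(−ghC) + χ(−gA))` (`collarClassSum_eq`, one companion sum `Σ_c χ(c² + a) = −1`),
`2·#{χ(−Q) = σ} = q − 2 − χ(−AhC) − σ·(χ(−ghC) + χ(−gA))` (`two_mul_card_collarClass_eq`); `A = 0, C ≠ 0` (Ȳ_B scalar): no null line, all `q − 1` lines of the ONE class
`χ(−ghC)`; `A ≠ 0, C = 0`: all of class `χ(−gA)`; `A = C = 0`: `Q ≡ 0` (§3).  The other nilpotent orientation `ē₂ ↦ A′ē₀` gives `Q = b²·(gh)·(C + h(A′∕4)b²)` — the same family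
with `(g, A, C) ↦ (gh, C, A′∕4)` after the square `b²` (§4).  Rows consumed (p07's case list, t₀): hair (3,2) `k_u = 1`: `(A, C) = (λ, μ)`; (3,3): `(y, μ − x)`; (3,2) `k_u = 2`:
`(y, −x)`; (3,1): `(0, μ)` resp. `(λ, 0)`.  Per vertex the line counts come in `±b` pairs; the datum `(A, C)` VARIES along the axis (dump 71f371ba: root `(3,1)` ⇒ `(Z, N₊, N₋) =
(0, 2, 2)`, next vertex `(4,1)` ⇒ `(2, 0, 2)` at `q = 5`), so the shell totals of (S-0)∕(S-1±) are sums of THESE per-vertex values (heir A-p12 (g24)).  The anisotropic literal `t₁`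
(root only) with SCALAR `Ȳ_B′` is §3's one-class rule verbatim (`collar_scalar_Q_eq`); its rank-2 root rows (N = 3) are not in this file.
HONEST LABEL: HC_CM is proved only modulo the 2 remaining named inputs (hLiu418 24832, h413 24833) until rung 0 closes; finite-field algebra only, nothing printed is asserted.

* §1 `collar_isotropic`, `collarQ_eq` (the datum: `v_b` is isotropic and `⟨v_b, Ȳv_b⟩ = g(A + hCb²)`, over any commutative ring with `2` invertible).
* §2 `card_collarNull_eq`, `collarClassSum_eq`, `two_mul_card_collarClass_eq` (`A·C ≠ 0`).
* §3 `card_collarNull_eq_zero_of_A_eq_zero`, `quadraticChar_neg_collarQ_of_A_eq_zero`, `card_collarNull_eq_zero_of_C_eq_zero`, `quadraticChar_neg_collarQ_of_C_eq_zero`,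
  `card_collarClass_of_const`, `collar_scalar_Q_eq`.
* §4 `collarQ'_eq`, `quadraticChar_neg_collarQ'_eq` (the other orientation).

## References
* [Rogawski1990] J. D. Rogawski, *Automorphic Representations of Unitary Groups in Three Variables*, Ann. of Math. Stud. 123 (1990), §4.9 Prop. 4.9.1 (b) p. 55 (the type-(2)
  ramified transfer), Lemma 4.9.3 p. 56.
* [Kottwitz1986] R. E. Kottwitz, *Base change for unit elements of Hecke algebras*, Compositio Math. 60 (1986), §3 (shell-by-shell counting of fixed lattices).
* [IrelandRosen1990] K. Ireland, M. Rosen, *A Classical Introduction to Modern Number Theory*, GTM 84, Ch. 8 §1–§2 (quadratic character sums).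
* [LidlNiederreiter1996] R. Lidl, H. Niederreiter, *Finite Fields*, 2nd ed., Ch. 5 §4 (5.68), Theorem 5.50 (the companion sum `I₂(a) = −1`).
-/

set_option autoImplicit false

namespace Literature.NumberTheory.Rogawski1990

open Finset Matrix
open Literature.FieldTheory.FiniteFields.JacobsthalSums

/-! ## §1 The datum: the collar lines are isotropic and `Q(v_b) = g·(A + h·C·b²)` -/

section Datum

variable {R : Type*} [CommRing R]

/-- **The collar line `v_b = ē₀ + bē₁ − (hb²∕2)ē₂` is isotropic** for the Gram matrix `g·antidiag(1, h, 1)` (`2` invertible): `ᵗv_b·G·v_b = 0`.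
[cite: Kottwitz1986, §3] [cite: Rogawski1990, §4.9 p. 55] -/
theorem collar_isotropic (g h b t : R) (ht : 2 * t = 1) :
    dotProduct ![1, b, -(h * b ^ 2 * t)] ((g • !![0, 0, 1; 0, h, 0; 1, 0, 0] : Matrix (Fin 3) (Fin 3) R) *ᵥ ![1, b, -(h * b ^ 2 * t)]) = 0 := by
  simp [Matrix.mulVec, dotProduct, Fin.sum_univ_three]
  linear_combination (-(g * h * b ^ 2)) * ht

/-- **THE COLLAR DATUM `Q(v_b) = ⟨v_b, Ȳ v_b⟩ = g·(A + h·C·b²)`**, `C = μ − x`, for `Ȳ = (ē₀ ↦ xē₀ + Aē₂, ē₁ ↦ μē₁, ē₂ ↦ xē₂)` and the Gram matrix `g·antidiag(1, h, 1)` (`2t = 1`).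
[cite: Kottwitz1986, §3] [cite: Rogawski1990, §4.9 Prop. 4.9.1 (b) p. 55] -/
theorem collarQ_eq (g h A x μ b t : R) (ht : 2 * t = 1) :
    dotProduct ![1, b, -(h * b ^ 2 * t)]
        ((g • !![0, 0, 1; 0, h, 0; 1, 0, 0] : Matrix (Fin 3) (Fin 3) R) *ᵥ ((!![x, 0, 0; 0, μ, 0; A, 0, x] : Matrix (Fin 3) (Fin 3) R) *ᵥ ![1, b, -(h * b ^ 2 * t)])) =
      g * (A + h * (μ - x) * b ^ 2) := by
  simp [Matrix.mulVec, dotProduct, Fin.sum_univ_three]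
  linear_combination (-(g * h * x * b ^ 2)) * ht

end Datum

/-! ## §2 The census on the `q − 1` collar lines, `A·C ≠ 0` -/

section Census

variable {k : Type*} [Field k] [Fintype k] [DecidableEq k] {g h A C : k}

/-- **NULL COLLAR LINES: `#{b ≠ 0 : g(A + hCb²) = 0} = 1 + χ(−AhC)`** (`A, C, g, h ≠ 0`; `b² = −A∕(hC)` has `1 + χ` roots, all non-zero).
[cite: Rogawski1990, §4.9 Prop. 4.9.1 (b) p. 55] [cite: IrelandRosen1990, Ch. 8 §1] -/
theorem card_collarNull_eq (hk : ringChar k ≠ 2) (hg : g ≠ 0) (hh : h ≠ 0) (hA : A ≠ 0) (hC : C ≠ 0) :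
    ((univ.filter fun b : k => b ≠ 0 ∧ g * (A + h * C * b ^ 2) = 0).card : ℤ) = 1 + quadraticChar k (-(A * h * C)) := by
  have hhC : h * C ≠ 0 := mul_ne_zero hh hC
  have hset : (univ.filter fun b : k => b ≠ 0 ∧ g * (A + h * C * b ^ 2) = 0) = {x : k | x ^ 2 = -A / (h * C)}.toFinset := by
    ext b
    simp only [Finset.mem_filter, Finset.mem_univ, true_and, Set.mem_toFinset, Set.mem_setOf_eq]
    constructor
    · rintro ⟨-, hQ⟩
      have hQ' : A + h * C * b ^ 2 = 0 := by
        rcases mul_eq_zero.1 hQ with h1 | h1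
        · exact absurd h1 hg
        · exact h1
      rw [eq_div_iff hhC]
      linear_combination hQ'
    · intro hb
      refine ⟨?_, ?_⟩
      · rintro rfl
        rw [eq_div_iff hhC] at hb
        have : A = 0 := by linear_combination hb
        exact hA this
      · rw [hb]
        field_simp
        ring
  rw [hset, quadraticChar_card_sqrts hk (-A / (h * C))]
  have hval : -A / (h * C) = -(A * h * C) * ((h * C)⁻¹) ^ 2 := by field_simp
  rw [hval, map_mul, map_pow, quadraticChar_sq_one (inv_ne_zero hhC), mul_one, add_comm]

/-- **THE COLLAR CLASS SUM: `Σ_{b ≠ 0} χ(−g(A + hCb²)) = −(χ(−ghC) + χ(−gA))`** (`A, C, g, h ≠ 0`): `−g(A + hCb²) = −ghC·(b² + A∕(hC))`, the companion sum `Σ_b χ(b² + a) = −1`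
(★ `companionSum_two`), minus the `b = 0` term `χ(−gA)`. [cite: Rogawski1990, §4.9 Prop. 4.9.1 (b) p. 55] [cite: LidlNiederreiter1996, Theorem 5.50] [cite: IrelandRosen1990, Ch. 8 §2] -/
theorem collarClassSum_eq (hk : ringChar k ≠ 2) (hg : g ≠ 0) (hh : h ≠ 0) (hA : A ≠ 0) (hC : C ≠ 0) :
    (∑ b : k, if b ≠ 0 then quadraticChar k (-(g * (A + h * C * b ^ 2))) else 0) = -(quadraticChar k (-(g * h * C)) + quadraticChar k (-(g * A))) := by
  have hhC : h * C ≠ 0 := mul_ne_zero hh hC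
  have hfull : ∑ b : k, quadraticChar k (-(g * (A + h * C * b ^ 2))) = -quadraticChar k (-(g * h * C)) := by
    have hrw : ∀ b : k, -(g * (A + h * C * b ^ 2)) = -(g * h * C) * (b ^ 2 + A / (h * C)) := fun b => by field_simp; ring
    simp_rw [hrw, map_mul]
    rw [← Finset.mul_sum]
    have hI : ∑ b : k, quadraticChar k (b ^ 2 + A / (h * C)) = -1 := companionSum_two hk (div_ne_zero hA hhC)
    rw [hI, mul_neg, mul_one]
  have hsplit : ∑ b : k, quadraticChar k (-(g * (A + h * C * b ^ 2))) =
      (∑ b : k, if b ≠ 0 then quadraticChar k (-(g * (A + h * C * b ^ 2))) else 0) + quadraticChar k (-(g * A)) := by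
    have hpt : ∀ b : k, quadraticChar k (-(g * (A + h * C * b ^ 2))) =
        (if b ≠ 0 then quadraticChar k (-(g * (A + h * C * b ^ 2))) else 0) + (if b = 0 then quadraticChar k (-(g * A)) else 0) := by
      intro b
      by_cases hb : b = 0
      · simp [hb]
      · simp [hb]
    rw [Fintype.sum_congr _ _ hpt, Finset.sum_add_distrib, Finset.sum_ite_eq' Finset.univ (0 : k), if_pos (Finset.mem_univ _)]
  linear_combination hfull - hsplit

/-- **THE COLLAR CLASS SPLIT: `2·#{b ≠ 0 : χ(−g(A + hCb²)) = σ} = q − 2 − χ(−AhC) − σ·(χ(−ghC) + χ(−gA))`** for `σ = ±1` (`A, C, g, h ≠ 0`; `q = |k|`).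
[cite: Rogawski1990, §4.9 Prop. 4.9.1 (b) p. 55] [cite: IrelandRosen1990, Ch. 8 §1] -/
theorem two_mul_card_collarClass_eq (hk : ringChar k ≠ 2) (hg : g ≠ 0) (hh : h ≠ 0) (hA : A ≠ 0) (hC : C ≠ 0) {σ : ℤ} (hσ : σ = 1 ∨ σ = -1) :
    2 * ((univ.filter fun b : k => b ≠ 0 ∧ quadraticChar k (-(g * (A + h * C * b ^ 2))) = σ).card : ℤ) =
      (Fintype.card k : ℤ) - 2 - quadraticChar k (-(A * h * C)) - σ * (quadraticChar k (-(g * h * C)) + quadraticChar k (-(g * A))) := by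
  rw [two_mul_card_filter_quadraticChar_eq (k := k) (fun b : k => b ≠ 0) (fun b => -(g * (A + h * C * b ^ 2))) hσ, collarClassSum_eq hk hg hh hA hC]
  have h1 : ((univ.filter fun b : k => b ≠ 0).card : ℤ) = (Fintype.card k : ℤ) - 1 := by
    rw [Finset.filter_ne' univ (0 : k), Finset.card_erase_of_mem (Finset.mem_univ _), Finset.card_univ, Nat.cast_sub Fintype.card_pos, Nat.cast_one]
  have h2 : ((univ.filter fun b : k => b ≠ 0 ∧ -(g * (A + h * C * b ^ 2)) = 0).card : ℤ) = 1 + quadraticChar k (-(A * h * C)) := by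
    rw [← card_collarNull_eq hk hg hh hA hC]
    congr 2
    ext b
    simp only [Finset.mem_filter, Finset.mem_univ, true_and, neg_eq_zero]
  rw [h1, h2]
  ring

end Census

/-! ## §3 The one-class cases (`A = 0` or `C = 0`) and the scalar rule -/

section OneClass

variable {k : Type*} [Field k] [Fintype k] [DecidableEq k] {g h A C : k}

/-- `A = 0`, `C ≠ 0` (Ȳ_B scalar): NO null collar line. [cite: Rogawski1990, §4.9 Prop. 4.9.1 (b) p. 55] -/
theorem card_collarNull_eq_zero_of_A_eq_zero (hg : g ≠ 0) (hh : h ≠ 0) (hA : A = 0) (hC : C ≠ 0) :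
    (univ.filter fun b : k => b ≠ 0 ∧ g * (A + h * C * b ^ 2) = 0).card = 0 := by
  rw [Finset.card_eq_zero, Finset.filter_eq_empty_iff]
  rintro b - ⟨hb, hQ⟩
  rw [hA, zero_add] at hQ
  exact absurd hQ (mul_ne_zero hg (mul_ne_zero (mul_ne_zero hh hC) (pow_ne_zero 2 hb)))

/-- `A = 0`, `C ≠ 0`: every collar line has the SAME class `χ(−Q(v_b)) = χ(−ghC)`. [cite: Rogawski1990, §4.9 Prop. 4.9.1 (b) p. 55] [cite: IrelandRosen1990, Ch. 8 §1] -/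
theorem quadraticChar_neg_collarQ_of_A_eq_zero (hA : A = 0) {b : k} (hb : b ≠ 0) :
    quadraticChar k (-(g * (A + h * C * b ^ 2))) = quadraticChar k (-(g * h * C)) := by
  rw [hA, zero_add, show -(g * (h * C * b ^ 2)) = -(g * h * C) * b ^ 2 by ring, map_mul, map_pow, quadraticChar_sq_one hb, mul_one]

/-- `A ≠ 0`, `C = 0` (`μ = x`): NO null collar line. [cite: Rogawski1990, §4.9 Prop. 4.9.1 (b) p. 55] -/
theorem card_collarNull_eq_zero_of_C_eq_zero (hg : g ≠ 0) (hA : A ≠ 0) (hC : C = 0) :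
    (univ.filter fun b : k => b ≠ 0 ∧ g * (A + h * C * b ^ 2) = 0).card = 0 := by
  rw [Finset.card_eq_zero, Finset.filter_eq_empty_iff]
  rintro b - ⟨-, hQ⟩
  rw [hC, mul_zero, zero_mul, add_zero] at hQ
  exact absurd hQ (mul_ne_zero hg hA)

/-- `A ≠ 0`, `C = 0`: every collar line has the SAME class `χ(−Q(v_b)) = χ(−gA)`. [cite: Rogawski1990, §4.9 Prop. 4.9.1 (b) p. 55] -/
theorem quadraticChar_neg_collarQ_of_C_eq_zero (hC : C = 0) (b : k) :
    quadraticChar k (-(g * (A + h * C * b ^ 2))) = quadraticChar k (-(g * A)) := by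
  rw [hC, mul_zero, zero_mul, add_zero]

/-- **One-class count**: if `χ(−Q(v_b)) = s` for every `b ≠ 0`, then `#{b ≠ 0 : χ(−Q(v_b)) = σ} = [s = σ]·(q − 1)`. [cite: IrelandRosen1990, Ch. 8 §1] -/
theorem card_collarClass_of_const {Q : k → k} {s σ : ℤ} (hs : ∀ b : k, b ≠ 0 → quadraticChar k (-(Q b)) = s) :
    (univ.filter fun b : k => b ≠ 0 ∧ quadraticChar k (-(Q b)) = σ).card = if s = σ then Fintype.card k - 1 else 0 := by
  split_ifs with hσ
  · have hset : (univ.filter fun b : k => b ≠ 0 ∧ quadraticChar k (-(Q b)) = σ) = univ.erase 0 := by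
      ext b
      simp only [Finset.mem_filter, Finset.mem_univ, true_and, Finset.mem_erase, and_true]
      exact ⟨fun hb => hb.1, fun hb => ⟨hb, (hs b hb).trans hσ⟩⟩
    rw [hset, Finset.card_erase_of_mem (Finset.mem_univ _), Finset.card_univ]
  · rw [Finset.card_eq_zero, Finset.filter_eq_empty_iff]
    rintro b - ⟨hb, hbσ⟩
    exact hσ ((hs b hb).symm.trans hbσ)

omit [Fintype k] [DecidableEq k] in
/-- **THE SCALAR RULE** (both literals; `Ȳ_B = x·1` on the plane, `μ` on the line): on an isotropic vector (`C_B(w) + θy² = 0`) the leading form is `x·C_B(w) + μθy² = (μ − x)·θ·y²`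
— one class `χ(−(μ−x)θ)` on every non-axial line (`y ≠ 0`), no null line unless `μ = x`. [cite: Rogawski1990, §4.9 Prop. 4.9.1 (b) p. 55] -/
theorem collar_scalar_Q_eq {CB θ y x μ : k} (hiso : CB + θ * y ^ 2 = 0) : x * CB + μ * θ * y ^ 2 = (μ - x) * θ * y ^ 2 := by
  linear_combination x * hiso

end OneClass

/-! ## §4 The other nilpotent orientation `ē₂ ↦ A′ē₀` -/

section Orientation

variable {R : Type*} [CommRing R]

/-- For `Ȳ′ = (ē₀ ↦ xē₀, ē₁ ↦ μē₁, ē₂ ↦ A′ē₀ + xē₂)`: `⟨v_b, Ȳ′v_b⟩ = g·(hCb² + h²A′b⁴t²)` (`2t = 1`, `C = μ − x`), i.e. `b²·(gh)·(C + h(A′t²)b²)`.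
[cite: Kottwitz1986, §3] [cite: Rogawski1990, §4.9 Prop. 4.9.1 (b) p. 55] -/
theorem collarQ'_eq (g h A' x μ b t : R) (ht : 2 * t = 1) :
    dotProduct ![1, b, -(h * b ^ 2 * t)]
        ((g • !![0, 0, 1; 0, h, 0; 1, 0, 0] : Matrix (Fin 3) (Fin 3) R) *ᵥ ((!![x, 0, A'; 0, μ, 0; 0, 0, x] : Matrix (Fin 3) (Fin 3) R) *ᵥ ![1, b, -(h * b ^ 2 * t)])) =
      b ^ 2 * ((g * h) * ((μ - x) + h * (A' * t ^ 2) * b ^ 2)) := by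
  simp [Matrix.mulVec, dotProduct, Fin.sum_univ_three]
  linear_combination (-(g * h * x * b ^ 2)) * ht

end Orientation

section Orientation'

variable {k : Type*} [Field k] [Fintype k] [DecidableEq k]

/-- The square `b²` drops out of the class: `χ(−b²·Q) = χ(−Q)` for `b ≠ 0` — so the `ē₂ ↦ A′ē₀` orientation is the census of §2–§3 with `(g, A, C) ↦ (gh, C, A′t²)`.
[cite: IrelandRosen1990, Ch. 8 §1] -/
theorem quadraticChar_neg_collarQ'_eq (Q : k) {b : k} (hb : b ≠ 0) : quadraticChar k (-(b ^ 2 * Q)) = quadraticChar k (-Q) := by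
  rw [show -(b ^ 2 * Q) = -Q * b ^ 2 by ring, map_mul, map_pow, quadraticChar_sq_one hb, mul_one]

end Orientation'

end Literature.NumberTheory.Rogawski1990
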